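import Summits.ABC.IUTFork.Thm311RealInd1StripHull
import Literature.IUT.LogVolume.LogUnitsTraceZeroDyadicSqrtNegOne
import HarnessLib

/-!
# [IUTchIII] Thm 3.11 (i) (Ind1)+(Ind2) at a DYADIC place `K_v ≅ ℚ₂(√−1)`: the hull washout of `Thm311RealInd1StripHull` FAILS by exactly one
# shell — the ceiling of print's orbit span has the container's `𝒪_{K_v}`-hull iff the region ALREADY reaches the container's top shell
# (UNCONDITIONAL; the `p = 2` VOLUME side at the single place, `(e, f) = (2, 1)`)

PROOF-ONLY file (abc-iut cell, Cor. 3.12 sub-crew, seat abc-iut-c312-1 = holder of record of the typed [IUTchIII] Thm. 3.11, gen 24; row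
«C:P2-HULL-GAP», file 2/2, over `Thm311RealInd1StripHull` (p528030, R19), `Thm311RealInd1StripOrbitSpan` (p516833, R17b: the ceiling is
`p`-GENERIC) and the classical `Literature.IUT.LogVolume.TraceZeroDyadicSqrtNegOne` (file 1/2)).  TAKES NO SIDE on [IUTchIII] Cor. 3.12.
No definition, no `Prop` fact, no instance, no notation; no Jannsen–Wingberg / Diekert–Nishio binder.

WHY.  R19 (`coe_span_add_inter_ker_eq_of_tame`): at a TAME place of local degree `≥ 2` the ceiling `M + (c·log_p(𝒪_v^×) ∩ Ker Tr)` of the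
print-(Ind1)⊔(Ind2) orbit span of ANY region `0 ∈ M ⊆ c·log_p(𝒪_v^×)` has the SAME `𝒪_{K_v}`-hull as Dupuy–Hilado's container span
`c·log_p(𝒪_v^×)` (the trace-zero sublattice is co-radial), and its HONEST SCOPE names the wild exception `ℚ₂(√−1)`.  R32
(`…_two_of_sum_eq`) then showed that `p = 2` is a support prime of EVERY genuine Θ-volume input, so the global identity AS TYPED always has a
`p = 2` summand outside every R-row; R33 gave the (Ind1) strip part its dyadic engine (structure only).  THIS FILE is the first VOLUME-side
statement at `p = 2`, at the single place, for the dyadic shape where `log₂(𝒪_v^×)` is a ball: `K_v ∋ √−1` with `(e(v|2), f(v|2)) = (2, 1)`,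
i.e. `K_v ≅ ℚ₂(√−1)`, `log₂(𝒪_v^×) = 𝔪_v³` (abc-iut-w4-d017) — for a number field containing `√−1` (every base field of an initial Θ-datum,
[IUTchI] Def. 3.1 (a)) these are exactly its dyadic places of local degree `2` (§5):

* §1 radii: `isGreatest_norm_smul_logUnits_of_dyadicSqrtNegOne` — the container span `c·log₂(𝒪_v^×)` has maximal norm `‖c‖·‖ϖ‖³`;
  `isGreatest_norm_smul_logUnits_inter_ker_of_dyadicSqrtNegOne` — its trace-zero part has maximal norm `‖c‖·‖ϖ‖⁴` (file 1/2: trace-zero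
  elements have even `ϖ`-valuation; `4i` attains);
* §2 the CEILING (p516833 §1, unconditional, `p`-generic: the orbit of a `ℤ₂`-stable region `M ⊆ c·log₂(𝒪_v^×)` under the group generated by
  `Real.ind1Strip ∪ Real.ismIsm` never leaves `M + (c·log₂(𝒪_v^×) ∩ Ker Tr)`): `norm_le_max_of_mem_add_inter_ker_of_dyadicSqrtNegOne` (radius
  `≤ max(r_M, ‖c‖‖ϖ‖⁴)`), **`isGreatest_norm_add_inter_ker_of_dyadicSqrtNegOne`** (for `0 ∈ M` with maximal norm `r`: the ceiling's maximal
  norm is EXACTLY `max(r, ‖c‖‖ϖ‖⁴)`), `…_of_deep` (DEEP regions `M ⊆ c·𝔪_v⁴`: ceiling radius `‖c‖‖ϖ‖⁴`);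
* §3 hulls over `𝒪_{K_v} = Valued.integer` (R19 §0 `Hull.coe_span_eq_closedBall_of_isGreatest`): `coe_span_smul_logUnits_eq_closedBall_…`
  (container hull `B(0, ‖c‖‖ϖ‖³)`), **`coe_span_add_inter_ker_eq_closedBall_of_dyadicSqrtNegOne`** (ceiling hull `B(0, max(r, ‖c‖‖ϖ‖⁴))`),
  **`coe_span_add_inter_ker_ne_coe_span_smul_logUnits_of_deep`** (`c ≠ 0`, `M ⊆ c·𝔪_v⁴`: the two hulls DIFFER — `c·ϖ³` lies in the
  container's hull and not in the ceiling's; R19's washout FAILS here, by the one shell `[𝔪³ : 𝔪⁴] = 2`),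
  `coe_span_add_inter_ker_eq_coe_span_self_of_isGreatest` (SHALLOW regions, `r ≥ ‖c‖‖ϖ‖⁴`: hull(ceiling) = hull(`M`) — the typed
  indeterminacies add NOTHING to the hull), and the displayed equivalence **`coe_span_add_inter_ker_eq_coe_span_smul_logUnits_iff`**:
  hull(ceiling) = hull(container) ⟺ `r = ‖c‖‖ϖ‖³` — iff `M` ITSELF already reaches the container's top shell;
* §4 orbit forms: `norm_of_apply_le_max_of_mem_closure_ind_of_dyadicSqrtNegOne` (`γ ∈ ⟨Real.ind1Strip ∪ Real.ismIsm⟩`, `x ∈ M`: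
  `‖γ x‖ ≤ max(r, ‖c‖‖ϖ‖⁴)`), **`norm_of_apply_lt_of_deep`** (deep `M`, `c ≠ 0`: `‖γ x‖ < ‖c‖‖ϖ‖³` — print's (Ind1)⊔(Ind2) AS TYPED NEVER
  lifts a deep region into the container's top shell, in contrast with R19's `norm_of_apply_le_of_mem_closure_ind` being attained at tame places);
* §5 `absRamificationIdx_eq_two_and_residueDegree_eq_one_of_localDeg_eq_two` — `√−1 ∈ K_v` and `[K_v : ℚ₂] = 2` give `(e, f) = (2, 1)`
  (`e ≥ 2`, abc-iut-w5-d039; `e·f = 2`): the statements hold at every dyadic place of local degree `2` of a number field `∋ √−1` (`…_iff_of_localDeg_eq_two`).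
READING (numbers about OUR typed objects, ONE dyadic place): at `K_v ≅ ℚ₂(√−1)` the trace-zero direction that print's (Ind1) strip part is
confined to (R13/R17b) sits one shell below the top of Dupuy–Hilado's container, so — unlike at every tame place of local degree `≥ 2` — the
ceiling of print's (Ind1)⊔(Ind2) orbit span does NOT automatically fill the container's hull: it does so iff the region was already at the
top shell, and for every deeper region the hull of whatever print's indeterminacies AS TYPED reach is at most `c·𝔪_v⁴`, of index `≥ 2` in
the container's hull `c·𝔪_v³`.  HONEST SCOPE: single place; the shape `(e, f) = (2, 1)` only (the other dyadic shapes, where `log₂(𝒪_v^×)` is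
not a ball, are NOT treated); OUR typing of print's (Ind1)/(Ind2) (THE equivariant lift, THE logarithm; referee F-B28-1's matter untouched);
nothing here computes a tensor-packet hull, a log-volume or the `p = 2` summand of R32, and which regions a Θ-pilot presents at `v` is NOT
claimed; (Ind3) and the log-link untouched; no side taken on [IUTchIII] Cor. 3.12 / [IUTchIV] Thm. 1.10 or on any author; NO abc claim.
[claim: Mochizuki2012, status: disputed]; [cite: Mochizuki2012, IUTchIII Rmk. 3.9.5 (i) p. 126; Thm. 3.11 (i) (Ind1)(Ind2) p. 154; Cor. 3.12
Step (xi) p. 183; IUTchIV Prop. 1.2 (i) p. 10; IUTchI Def. 3.1 (a) p. 61]; [cite: DupuyHilado2025, §4.9, §4.12]; [cite: NeukirchANT1999, Ch. II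
Prop. (5.5), (5.7)]. typed ≠ proved; located ≠ adjudicated. -/

set_option autoImplicit false

noncomputable section

open Metric Set
open scoped Pointwise

namespace Summit.ABC.IUTFork.Thm311.Real

open NumberField IsDedekindDomain Literature.NumberTheory.NumberFields Literature.IUT.LogVolume
open Literature.NumberTheory.GaloisRepresentations Literature.NumberTheory.GaloisRepresentations.Ultrametric
open Literature.AnabelianGeometry.AbsoluteAnabelian Literature.IUT.HodgeArakelov
open Literature.IUT.HodgeArakelov.AbsTopMonoids Literature.IUT.LogThetaLattice
open Literature.IUT.LogVolume.TraceZeroDyadicSqrtNegOne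

variable {F : Type} [Field F] [NumberField F] (v : HeightOneSpectrum (𝓞 F))
variable (hv : ((2 : ℕ) : 𝓞 F) ∈ v.asIdeal)

section DyadicSqrtNegOne

variable {i : RescaledCompletion F 2 v hv} (hi : i ^ 2 = -1)
  (he : absRamificationIdx 2 (RescaledCompletion F 2 v hv) = 2) (hf : residueDegree 2 (RescaledCompletion F 2 v hv) = 1)
  {ϖ : (RescaledCompletion F 2 v hv)ˣ} (hϖ : IsUniformizer ϖ)

include hi he hf hϖ

/-! ## §1 Radii of the container span and of its trace-zero part -/

/-- **The container's radius.**  At a place `v ∣ 2` with `√−1 ∈ K_v`, `(e, f) = (2, 1)`: the container span `c·log₂(𝒪_v^×) = c·𝔪_v³`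
attains its maximal norm `‖c‖·‖ϖ‖³` (at `c·ϖ³`). [cite: Mochizuki2012, IUTchIV Prop. 1.2 (i) p. 10] [cite: DupuyHilado2025, §4.9]
[cite: NeukirchANT1999, Ch. II Prop. (5.5)] [claim: Mochizuki2012, status: disputed] -/
theorem isGreatest_norm_smul_logUnits_of_dyadicSqrtNegOne (c : ℚ_[2]) :
    IsGreatest ((‖·‖) '' (c • logUnits (RescaledCompletion F 2 v hv)))
      (‖c‖ * ‖(ϖ : RescaledCompletion F 2 v hv)‖ ^ (3 : ℤ)) := by
  obtain ⟨⟨z, hz, hz3⟩, hub⟩ := isGreatest_norm_logUnits hϖ hi he hf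
  change ‖z‖ = _ at hz3
  refine ⟨⟨c • z, Set.smul_mem_smul_set hz, by change ‖c • z‖ = _; rw [norm_smul, hz3]⟩, ?_⟩
  rintro _ ⟨_, ⟨y, hy, rfl⟩, rfl⟩
  change ‖c • y‖ ≤ _
  rw [norm_smul]
  exact mul_le_mul_of_nonneg_left (hub ⟨y, hy, rfl⟩) (norm_nonneg c)

/-- **The trace-zero part of the container has radius `‖c‖·‖ϖ‖⁴`** — ONE SHELL BELOW the container's `‖c‖·‖ϖ‖³`: every trace-zero unit
logarithm of `K_v ≅ ℚ₂(√−1)` has norm `≤ ‖ϖ‖⁴` (file 1/2, `norm_le_zpow_four_of_mem_logUnits_of_trace_eq_zero`) and `c·4i` attains.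
[cite: NeukirchANT1999, Ch. II Prop. (5.5), (5.7)] [cite: DupuyHilado2025, §4.9] [claim: Mochizuki2012, status: disputed] -/
theorem isGreatest_norm_smul_logUnits_inter_ker_of_dyadicSqrtNegOne (c : ℚ_[2]) :
    IsGreatest ((‖·‖) '' (c • logUnits (RescaledCompletion F 2 v hv) ∩
        {w | Algebra.trace ℚ_[2] (RescaledCompletion F 2 v hv) w = 0}))
      (‖c‖ * ‖(ϖ : RescaledCompletion F 2 v hv)‖ ^ (4 : ℤ)) := by
  obtain ⟨hL, htr, hnorm⟩ := smul_mem_logUnits_trace_eq_zero_norm_eq hϖ hi he hf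
  refine ⟨⟨c • ((4 : RescaledCompletion F 2 v hv) * i), ⟨Set.smul_mem_smul_set hL, ?_⟩, ?_⟩, ?_⟩
  · change Algebra.trace ℚ_[2] (RescaledCompletion F 2 v hv) (c • ((4 : RescaledCompletion F 2 v hv) * i)) = 0
    rw [map_smul, htr, smul_zero]
  · change ‖c • ((4 : RescaledCompletion F 2 v hv) * i)‖ = _
    rw [norm_smul, hnorm]
  · rintro _ ⟨x, ⟨hx, hxtr⟩, rfl⟩
    change ‖x‖ ≤ _
    obtain ⟨y, hy, rfl⟩ := Set.mem_smul_set.mp hx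
    change Algebra.trace ℚ_[2] (RescaledCompletion F 2 v hv) (c • y) = 0 at hxtr
    rw [norm_smul]
    by_cases hc : c = 0
    · rw [hc, norm_zero, zero_mul, zero_mul]
    · rw [map_smul, smul_eq_zero] at hxtr
      exact mul_le_mul_of_nonneg_left
        (norm_le_zpow_four_of_mem_logUnits_of_trace_eq_zero hϖ hi he hf hy (hxtr.resolve_left hc)) (norm_nonneg c)

omit hi he hf in
/-- `‖c‖·‖ϖ‖⁴ ≤ ‖c‖·‖ϖ‖³` (and `<` for `c ≠ 0`, `lt_of_ne`): the trace-zero shell is below the top. [cite: NeukirchANT1999, Ch. II Prop. (5.5)] -/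
theorem norm_mul_zpow_four_le_norm_mul_zpow_three (c : ℚ_[2]) :
    ‖c‖ * ‖(ϖ : RescaledCompletion F 2 v hv)‖ ^ (4 : ℤ) ≤ ‖c‖ * ‖(ϖ : RescaledCompletion F 2 v hv)‖ ^ (3 : ℤ) :=
  mul_le_mul_of_nonneg_left
    (zpow_lt_zpow_right_of_lt_one₀ (norm_units_pos ϖ) hϖ.1 (by norm_num)).le (norm_nonneg c)

omit hi he hf in
/-- For `c ≠ 0`: `‖c‖·‖ϖ‖⁴ < ‖c‖·‖ϖ‖³`. [cite: NeukirchANT1999, Ch. II Prop. (5.5)] -/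
theorem norm_mul_zpow_four_lt_norm_mul_zpow_three {c : ℚ_[2]} (hc : c ≠ 0) :
    ‖c‖ * ‖(ϖ : RescaledCompletion F 2 v hv)‖ ^ (4 : ℤ) < ‖c‖ * ‖(ϖ : RescaledCompletion F 2 v hv)‖ ^ (3 : ℤ) :=
  mul_lt_mul_of_pos_left (zpow_lt_zpow_right_of_lt_one₀ (norm_units_pos ϖ) hϖ.1 (by norm_num)) (norm_pos_iff.mpr hc)

/-! ## §2 The ceiling `M + (c·log₂(𝒪_v^×) ∩ Ker Tr)` of print's (Ind1)⊔(Ind2) orbit span: radius `max(r_M, ‖c‖‖ϖ‖⁴)` -/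

/-- **Upper bound for the ceiling (ultrametric).**  If every element of `M` has norm `≤ r`, every element of the ceiling
`M + (c·log₂(𝒪_v^×) ∩ Ker Tr)` of the print-(Ind1)⊔(Ind2) orbit span (p516833 §1) has norm `≤ max(r, ‖c‖·‖ϖ‖⁴)`.
[cite: Mochizuki2012, IUTchIII Thm. 3.11 (i) p. 154] [cite: NeukirchANT1999, Ch. II Prop. (5.5)] [claim: Mochizuki2012, status: disputed] -/
theorem norm_le_max_of_mem_add_inter_ker_of_dyadicSqrtNegOne (c : ℚ_[2]) {M : Set (RescaledCompletion F 2 v hv)} {r : ℝ}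
    (hMr : ∀ m ∈ M, ‖m‖ ≤ r) {z : RescaledCompletion F 2 v hv}
    (hz : z ∈ M + (c • logUnits (RescaledCompletion F 2 v hv) ∩ {w | Algebra.trace ℚ_[2] (RescaledCompletion F 2 v hv) w = 0})) :
    ‖z‖ ≤ max r (‖c‖ * ‖(ϖ : RescaledCompletion F 2 v hv)‖ ^ (4 : ℤ)) := by
  obtain ⟨m, hm, y, hy, rfl⟩ := hz
  exact (IsUltrametricDist.norm_add_le_max m y).trans
    (max_le_max (hMr m hm) ((isGreatest_norm_smul_logUnits_inter_ker_of_dyadicSqrtNegOne v hv hi he hf hϖ c).2 ⟨y, hy, rfl⟩))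

/-- **THE CEILING's RADIUS IS `max(r, ‖c‖‖ϖ‖⁴)` EXACTLY.**  At a place `v ∣ 2` with `√−1 ∈ K_v`, `(e, f) = (2, 1)`, for every `c ∈ ℚ₂` and
every region `M ∋ 0` with an element of maximal norm `r`: the ceiling `M + (c·log₂(𝒪_v^×) ∩ Ker Tr_{K_v/ℚ₂})` of the print-(Ind1)⊔(Ind2) orbit
span of `M` attains the maximal norm `max(r, ‖c‖·‖ϖ‖⁴)` (at `m₀ + 0`, resp. `0 + c·4i`) — compare R19 `isGreatest_norm_add_inter_ker_of_tame`,
where the ceiling's radius is the container's `‖c‖·p^{−1/e}` whatever `M` is. [cite: Mochizuki2012, IUTchIII Thm. 3.11 (i) p. 154; IUTchIV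
Prop. 1.2 (i) p. 10] [cite: NeukirchANT1999, Ch. II Prop. (5.5), (5.7)] [claim: Mochizuki2012, status: disputed] -/
theorem isGreatest_norm_add_inter_ker_of_dyadicSqrtNegOne (c : ℚ_[2]) {M : Set (RescaledCompletion F 2 v hv)} {r : ℝ}
    (h0 : (0 : RescaledCompletion F 2 v hv) ∈ M) (hMr : IsGreatest ((‖·‖) '' M) r) :
    IsGreatest ((‖·‖) '' (M + (c • logUnits (RescaledCompletion F 2 v hv) ∩
        {w | Algebra.trace ℚ_[2] (RescaledCompletion F 2 v hv) w = 0})))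
      (max r (‖c‖ * ‖(ϖ : RescaledCompletion F 2 v hv)‖ ^ (4 : ℤ))) := by
  obtain ⟨⟨m₀, hm₀, hm₀r⟩, hub⟩ := hMr
  change ‖m₀‖ = r at hm₀r
  have hMr' : ∀ m ∈ M, ‖m‖ ≤ r := fun m hm => hub ⟨m, hm, rfl⟩
  obtain ⟨⟨w₀, hw₀, hw₀n⟩, -⟩ := isGreatest_norm_smul_logUnits_inter_ker_of_dyadicSqrtNegOne v hv hi he hf hϖ c
  change ‖w₀‖ = _ at hw₀n
  have h0K : (0 : RescaledCompletion F 2 v hv) ∈ c • logUnits (RescaledCompletion F 2 v hv) ∩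
      {w | Algebra.trace ℚ_[2] (RescaledCompletion F 2 v hv) w = 0} :=
    ⟨by rw [← smul_zero c]; exact Set.smul_mem_smul_set (zero_mem_logUnits (p := 2)),
      by change Algebra.trace ℚ_[2] (RescaledCompletion F 2 v hv) 0 = 0; rw [map_zero]⟩
  refine ⟨?_, ?_⟩
  · rcases le_total (‖c‖ * ‖(ϖ : RescaledCompletion F 2 v hv)‖ ^ (4 : ℤ)) r with hle | hle
    · rw [max_eq_left hle]
      exact ⟨m₀ + 0, ⟨m₀, hm₀, 0, h0K, rfl⟩, by change ‖m₀ + 0‖ = r; rw [add_zero, hm₀r]⟩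
    · rw [max_eq_right hle]
      exact ⟨0 + w₀, ⟨0, h0, w₀, hw₀, rfl⟩, by change ‖(0 : RescaledCompletion F 2 v hv) + w₀‖ = _; rw [zero_add, hw₀n]⟩
  · rintro _ ⟨z, hz, rfl⟩
    exact norm_le_max_of_mem_add_inter_ker_of_dyadicSqrtNegOne v hv hi he hf hϖ c hMr' hz

/-- **DEEP regions** (`M ⊆ c·𝔪_v⁴`, i.e. every element of norm `≤ ‖c‖·‖ϖ‖⁴`, `0 ∈ M`): the ceiling's radius is `‖c‖·‖ϖ‖⁴` — the
trace-zero shell, NOT the container's `‖c‖·‖ϖ‖³`. [cite: Mochizuki2012, IUTchIII Thm. 3.11 (i) p. 154] [cite: NeukirchANT1999, Ch. II Prop. (5.5),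
(5.7)] [claim: Mochizuki2012, status: disputed] -/
theorem isGreatest_norm_add_inter_ker_of_deep (c : ℚ_[2]) {M : Set (RescaledCompletion F 2 v hv)}
    (h0 : (0 : RescaledCompletion F 2 v hv) ∈ M) (hM : ∀ m ∈ M, ‖m‖ ≤ ‖c‖ * ‖(ϖ : RescaledCompletion F 2 v hv)‖ ^ (4 : ℤ)) :
    IsGreatest ((‖·‖) '' (M + (c • logUnits (RescaledCompletion F 2 v hv) ∩
        {w | Algebra.trace ℚ_[2] (RescaledCompletion F 2 v hv) w = 0})))
      (‖c‖ * ‖(ϖ : RescaledCompletion F 2 v hv)‖ ^ (4 : ℤ)) := by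
  obtain ⟨⟨w₀, hw₀, hw₀n⟩, -⟩ := isGreatest_norm_smul_logUnits_inter_ker_of_dyadicSqrtNegOne v hv hi he hf hϖ c
  change ‖w₀‖ = _ at hw₀n
  refine ⟨⟨0 + w₀, ⟨0, h0, w₀, hw₀, rfl⟩, by change ‖(0 : RescaledCompletion F 2 v hv) + w₀‖ = _; rw [zero_add, hw₀n]⟩, ?_⟩
  rintro _ ⟨z, hz, rfl⟩
  have h := norm_le_max_of_mem_add_inter_ker_of_dyadicSqrtNegOne v hv hi he hf hϖ c hM hz
  rwa [max_self] at h

/-! ## §3 Hulls: the washout of R19 FAILS by exactly one shell -/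

/-- **The container's hull is `B(0, ‖c‖·‖ϖ‖³)`** (`= c·𝔪_v³` itself, a ball). [cite: Mochizuki2012, IUTchIII Rmk. 3.9.5 (i) p. 126; IUTchIV
Prop. 1.2 (i) p. 10] [cite: DupuyHilado2025, §4.12] [claim: Mochizuki2012, status: disputed] -/
theorem coe_span_smul_logUnits_eq_closedBall_of_dyadicSqrtNegOne (c : ℚ_[2]) :
    (Submodule.span (Valued.integer (RescaledCompletion F 2 v hv)) (c • logUnits (RescaledCompletion F 2 v hv)) :
        Set (RescaledCompletion F 2 v hv)) =
      closedBall 0 (‖c‖ * ‖(ϖ : RescaledCompletion F 2 v hv)‖ ^ (3 : ℤ)) :=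
  Hull.coe_span_eq_closedBall_of_isGreatest _ (valuedInteger_norm_le_one v 2 hv) (fun _ h => mem_valuedInteger_of_norm_le_one v 2 hv h)
    (isGreatest_norm_smul_logUnits_of_dyadicSqrtNegOne v hv hi he hf hϖ c)

/-- **The ceiling's hull is `B(0, max(r, ‖c‖·‖ϖ‖⁴))`** for a region `0 ∈ M` with maximal norm `r`. [cite: Mochizuki2012, IUTchIII Rmk. 3.9.5 (i)
p. 126; Thm. 3.11 (i) p. 154] [cite: NeukirchANT1999, Ch. II Prop. (5.5), (5.7)] [claim: Mochizuki2012, status: disputed] -/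
theorem coe_span_add_inter_ker_eq_closedBall_of_dyadicSqrtNegOne (c : ℚ_[2]) {M : Set (RescaledCompletion F 2 v hv)} {r : ℝ}
    (h0 : (0 : RescaledCompletion F 2 v hv) ∈ M) (hMr : IsGreatest ((‖·‖) '' M) r) :
    (Submodule.span (Valued.integer (RescaledCompletion F 2 v hv))
        (M + (c • logUnits (RescaledCompletion F 2 v hv) ∩ {w | Algebra.trace ℚ_[2] (RescaledCompletion F 2 v hv) w = 0})) :
        Set (RescaledCompletion F 2 v hv)) =
      closedBall 0 (max r (‖c‖ * ‖(ϖ : RescaledCompletion F 2 v hv)‖ ^ (4 : ℤ))) :=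
  Hull.coe_span_eq_closedBall_of_isGreatest _ (valuedInteger_norm_le_one v 2 hv) (fun _ h => mem_valuedInteger_of_norm_le_one v 2 hv h)
    (isGreatest_norm_add_inter_ker_of_dyadicSqrtNegOne v hv hi he hf hϖ c h0 hMr)

/-- **DEEP regions: the ceiling's hull is `B(0, ‖c‖·‖ϖ‖⁴) = c·𝔪_v⁴`.** [cite: Mochizuki2012, IUTchIII Rmk. 3.9.5 (i) p. 126; Thm. 3.11 (i) p. 154]
[cite: NeukirchANT1999, Ch. II Prop. (5.5), (5.7)] [claim: Mochizuki2012, status: disputed] -/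
theorem coe_span_add_inter_ker_eq_closedBall_of_deep (c : ℚ_[2]) {M : Set (RescaledCompletion F 2 v hv)}
    (h0 : (0 : RescaledCompletion F 2 v hv) ∈ M) (hM : ∀ m ∈ M, ‖m‖ ≤ ‖c‖ * ‖(ϖ : RescaledCompletion F 2 v hv)‖ ^ (4 : ℤ)) :
    (Submodule.span (Valued.integer (RescaledCompletion F 2 v hv))
        (M + (c • logUnits (RescaledCompletion F 2 v hv) ∩ {w | Algebra.trace ℚ_[2] (RescaledCompletion F 2 v hv) w = 0})) :
        Set (RescaledCompletion F 2 v hv)) =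
      closedBall 0 (‖c‖ * ‖(ϖ : RescaledCompletion F 2 v hv)‖ ^ (4 : ℤ)) :=
  Hull.coe_span_eq_closedBall_of_isGreatest _ (valuedInteger_norm_le_one v 2 hv) (fun _ h => mem_valuedInteger_of_norm_le_one v 2 hv h)
    (isGreatest_norm_add_inter_ker_of_deep v hv hi he hf hϖ c h0 hM)

omit hi he hf in
/-- `c·ϖ³` lies in `B(0, ‖c‖·‖ϖ‖³)` and, for `c ≠ 0`, NOT in `B(0, ‖c‖·‖ϖ‖⁴)`: the two balls differ. [cite: NeukirchANT1999, Ch. II Prop. (5.5)] -/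
theorem closedBall_zpow_four_ne_closedBall_zpow_three {c : ℚ_[2]} (hc : c ≠ 0) :
    closedBall (0 : RescaledCompletion F 2 v hv) (‖c‖ * ‖(ϖ : RescaledCompletion F 2 v hv)‖ ^ (4 : ℤ)) ≠
      closedBall 0 (‖c‖ * ‖(ϖ : RescaledCompletion F 2 v hv)‖ ^ (3 : ℤ)) := by
  intro h
  have hmem : c • (ϖ : RescaledCompletion F 2 v hv) ^ 3 ∈
      closedBall (0 : RescaledCompletion F 2 v hv) (‖c‖ * ‖(ϖ : RescaledCompletion F 2 v hv)‖ ^ (3 : ℤ)) := by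
    rw [mem_closedBall_zero_iff, norm_smul, norm_pow, zpow_ofNat]
  rw [← h, mem_closedBall_zero_iff, norm_smul, norm_pow, ← zpow_natCast, Nat.cast_ofNat] at hmem
  exact absurd hmem (not_le.mpr (norm_mul_zpow_four_lt_norm_mul_zpow_three v hv hϖ hc))

/-- **R19's WASHOUT FAILS AT `K_v ≅ ℚ₂(√−1)` (deep regions).**  For `c ≠ 0` and every region `0 ∈ M ⊆ c·𝔪_v⁴` the `𝒪_{K_v}`-hull of the
ceiling `M + (c·log₂(𝒪_v^×) ∩ Ker Tr)` of print's (Ind1)⊔(Ind2) orbit span is NOT the hull of Dupuy–Hilado's container span `c·log₂(𝒪_v^×)`: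
`B(0, ‖c‖‖ϖ‖⁴) ≠ B(0, ‖c‖‖ϖ‖³)` (index `[𝔪³ : 𝔪⁴] = 2`) — whereas at every TAME place of local degree `≥ 2` the two hulls coincide for
EVERY region (`coe_span_add_inter_ker_eq_of_tame`). [cite: Mochizuki2012, IUTchIII Rmk. 3.9.5 (i) p. 126; Thm. 3.11 (i) p. 154; Cor. 3.12
Step (xi) p. 183] [cite: DupuyHilado2025, §4.9, §4.12] [claim: Mochizuki2012, status: disputed] -/
theorem coe_span_add_inter_ker_ne_coe_span_smul_logUnits_of_deep {c : ℚ_[2]} (hc : c ≠ 0)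
    {M : Set (RescaledCompletion F 2 v hv)} (h0 : (0 : RescaledCompletion F 2 v hv) ∈ M)
    (hM : ∀ m ∈ M, ‖m‖ ≤ ‖c‖ * ‖(ϖ : RescaledCompletion F 2 v hv)‖ ^ (4 : ℤ)) :
    (Submodule.span (Valued.integer (RescaledCompletion F 2 v hv))
        (M + (c • logUnits (RescaledCompletion F 2 v hv) ∩ {w | Algebra.trace ℚ_[2] (RescaledCompletion F 2 v hv) w = 0})) :
        Set (RescaledCompletion F 2 v hv)) ≠
      Submodule.span (Valued.integer (RescaledCompletion F 2 v hv)) (c • logUnits (RescaledCompletion F 2 v hv)) := by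
  rw [coe_span_add_inter_ker_eq_closedBall_of_deep v hv hi he hf hϖ c h0 hM,
    coe_span_smul_logUnits_eq_closedBall_of_dyadicSqrtNegOne v hv hi he hf hϖ c]
  exact closedBall_zpow_four_ne_closedBall_zpow_three v hv hϖ hc

/-- **SHALLOW regions: the typed indeterminacies add NOTHING to the hull.**  If `M ∋ 0` attains a maximal norm `r ≥ ‖c‖·‖ϖ‖⁴`, the
`𝒪_{K_v}`-hull of the ceiling of its print-(Ind1)⊔(Ind2) orbit span is the hull of `M` itself (`= B(0, r)`). [cite: Mochizuki2012, IUTchIII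
Rmk. 3.9.5 (i) p. 126; Thm. 3.11 (i) p. 154] [cite: NeukirchANT1999, Ch. II Prop. (5.5)] [claim: Mochizuki2012, status: disputed] -/
theorem coe_span_add_inter_ker_eq_coe_span_self_of_isGreatest (c : ℚ_[2]) {M : Set (RescaledCompletion F 2 v hv)} {r : ℝ}
    (h0 : (0 : RescaledCompletion F 2 v hv) ∈ M) (hMr : IsGreatest ((‖·‖) '' M) r)
    (hr : ‖c‖ * ‖(ϖ : RescaledCompletion F 2 v hv)‖ ^ (4 : ℤ) ≤ r) :
    (Submodule.span (Valued.integer (RescaledCompletion F 2 v hv))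
        (M + (c • logUnits (RescaledCompletion F 2 v hv) ∩ {w | Algebra.trace ℚ_[2] (RescaledCompletion F 2 v hv) w = 0})) :
        Set (RescaledCompletion F 2 v hv)) =
      Submodule.span (Valued.integer (RescaledCompletion F 2 v hv)) M := by
  rw [coe_span_add_inter_ker_eq_closedBall_of_dyadicSqrtNegOne v hv hi he hf hϖ c h0 hMr, max_eq_left hr,
    Hull.coe_span_eq_closedBall_of_isGreatest _ (valuedInteger_norm_le_one v 2 hv)
      (fun _ h => mem_valuedInteger_of_norm_le_one v 2 hv h) hMr]

/-- **THE DISPLAYED EQUIVALENCE.**  At a place `v ∣ 2` with `√−1 ∈ K_v`, `(e, f) = (2, 1)`, for every `c ∈ ℚ₂` and every region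
`0 ∈ M ⊆ c·log₂(𝒪_v^×)` with an element of maximal norm `r`: the `𝒪_{K_v}`-hull of the ceiling `M + (c·log₂(𝒪_v^×) ∩ Ker Tr)` of print's
(Ind1)⊔(Ind2) orbit span EQUALS the hull of Dupuy–Hilado's container span `c·log₂(𝒪_v^×)` **iff `r = ‖c‖·‖ϖ‖³`**, i.e. iff `M` ITSELF already
reaches the container's top shell (⟹: `c·ϖ³` in the ceiling's hull `B(0, max(r, ‖c‖‖ϖ‖⁴))` forces `‖c‖‖ϖ‖³ ≤ r` since the trace-zero shell
is strictly lower for `c ≠ 0`; `r ≤ ‖c‖‖ϖ‖³` from `M ⊆ c·log₂(𝒪_v^×)`). [cite: Mochizuki2012, IUTchIII Rmk. 3.9.5 (i) p. 126; Thm. 3.11 (i) p. 154;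
Cor. 3.12 Step (xi) p. 183] [cite: DupuyHilado2025, §4.9, §4.12] [cite: NeukirchANT1999, Ch. II Prop. (5.5), (5.7)] [claim: Mochizuki2012,
status: disputed] -/
theorem coe_span_add_inter_ker_eq_coe_span_smul_logUnits_iff (c : ℚ_[2]) {M : Set (RescaledCompletion F 2 v hv)} {r : ℝ}
    (h0 : (0 : RescaledCompletion F 2 v hv) ∈ M) (hM : M ⊆ c • logUnits (RescaledCompletion F 2 v hv))
    (hMr : IsGreatest ((‖·‖) '' M) r) :
    (Submodule.span (Valued.integer (RescaledCompletion F 2 v hv))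
        (M + (c • logUnits (RescaledCompletion F 2 v hv) ∩ {w | Algebra.trace ℚ_[2] (RescaledCompletion F 2 v hv) w = 0})) :
        Set (RescaledCompletion F 2 v hv)) =
      Submodule.span (Valued.integer (RescaledCompletion F 2 v hv)) (c • logUnits (RescaledCompletion F 2 v hv)) ↔
      r = ‖c‖ * ‖(ϖ : RescaledCompletion F 2 v hv)‖ ^ (3 : ℤ) := by
  have hts : ‖c‖ * ‖(ϖ : RescaledCompletion F 2 v hv)‖ ^ (4 : ℤ) ≤ ‖c‖ * ‖(ϖ : RescaledCompletion F 2 v hv)‖ ^ (3 : ℤ) :=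
    norm_mul_zpow_four_le_norm_mul_zpow_three v hv hϖ c
  -- `r ≤ ‖c‖‖ϖ‖³` since `M ⊆ c·log₂(𝒪_v^×)`
  have hrs : r ≤ ‖c‖ * ‖(ϖ : RescaledCompletion F 2 v hv)‖ ^ (3 : ℤ) := by
    obtain ⟨⟨m₀, hm₀, hm₀r⟩, -⟩ := hMr
    change ‖m₀‖ = r at hm₀r
    rw [← hm₀r]
    exact (isGreatest_norm_smul_logUnits_of_dyadicSqrtNegOne v hv hi he hf hϖ c).2 ⟨m₀, hM hm₀, rfl⟩
  rw [coe_span_add_inter_ker_eq_closedBall_of_dyadicSqrtNegOne v hv hi he hf hϖ c h0 hMr,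
    coe_span_smul_logUnits_eq_closedBall_of_dyadicSqrtNegOne v hv hi he hf hϖ c]
  constructor
  · intro h
    -- `c·ϖ³ ∈ B(0, ‖c‖‖ϖ‖³) = B(0, max r (‖c‖‖ϖ‖⁴))` ⟹ `‖c‖‖ϖ‖³ ≤ max r (‖c‖‖ϖ‖⁴)`
    have hmem : c • (ϖ : RescaledCompletion F 2 v hv) ^ 3 ∈
        closedBall (0 : RescaledCompletion F 2 v hv) (max r (‖c‖ * ‖(ϖ : RescaledCompletion F 2 v hv)‖ ^ (4 : ℤ))) := by
      rw [h, mem_closedBall_zero_iff, norm_smul, norm_pow, zpow_ofNat]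
    rw [mem_closedBall_zero_iff, norm_smul, norm_pow, ← zpow_natCast, Nat.cast_ofNat] at hmem
    refine le_antisymm hrs ?_
    by_cases hc : c = 0
    · -- `c = 0`: `0 ≤ r = ‖m₀‖`
      obtain ⟨⟨m₀, -, hm₀r⟩, -⟩ := hMr
      change ‖m₀‖ = r at hm₀r
      rw [hc, norm_zero, zero_mul, ← hm₀r]
      exact norm_nonneg _
    · rcases le_max_iff.mp hmem with h1 | h1
      · exact h1
      · exact absurd h1 (not_le.mpr (norm_mul_zpow_four_lt_norm_mul_zpow_three v hv hϖ hc))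
  · intro h
    rw [h, max_eq_left hts]

/-! ## §4 Orbit forms -/

/-- **Orbit form of the ceiling bound.**  For `γ` in the group generated by print's (Ind1) strip part `Real.ind1Strip (analyticLogv F) v` and
print's (Ind2) `Real.ismIsm (analyticLogv F) v`, every `ℤ₂`-stable region `M ⊆ c·log₂(𝒪_v^×)` all of whose elements have norm `≤ r`, and
`x ∈ M`: `‖γ x‖ ≤ max(r, ‖c‖·‖ϖ‖⁴)` (the ceiling is `p`-generic, p516833 `orbit_subset_add_of_mem_closure_ind`). [cite: Mochizuki2012,
IUTchIII Thm. 3.11 (i) (Ind1)(Ind2) p. 154] [cite: DupuyHilado2025, §4.9] [claim: Mochizuki2012, status: disputed] -/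
theorem norm_of_apply_le_max_of_mem_closure_ind_of_dyadicSqrtNegOne
    {γ : Carrier (.inr v : Place F) ≃ₗ[ℚ] Carrier (.inr v : Place F)}
    (hγ : γ ∈ Subgroup.closure (ind1Strip (analyticLogv F) v ∪ ismIsm (analyticLogv F) v)) (c : ℚ_[2])
    (M : AddSubgroup (RescaledCompletion F 2 v hv))
    (hMs : ∀ u : ℚ_[2], ‖u‖ ≤ 1 → ∀ z ∈ M, u • z ∈ M)
    (hM : (M : Set (RescaledCompletion F 2 v hv)) ⊆ c • logUnits (RescaledCompletion F 2 v hv))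
    {r : ℝ} (hMr : ∀ m ∈ M, ‖m‖ ≤ r)
    {x : v.adicCompletion F} (hx : RescaledCompletion.of F 2 v hv x ∈ M) :
    ‖RescaledCompletion.of F 2 v hv (γ x)‖ ≤ max r (‖c‖ * ‖(ϖ : RescaledCompletion F 2 v hv)‖ ^ (4 : ℤ)) :=
  norm_le_max_of_mem_add_inter_ker_of_dyadicSqrtNegOne v hv hi he hf hϖ c (fun m hm => hMr m hm)
    (orbit_subset_add_of_mem_closure_ind v 2 hv hγ c M hMs hM hx)

/-- **DEEP REGIONS ARE NEVER LIFTED INTO THE CONTAINER's TOP SHELL.**  For `c ≠ 0`, a `ℤ₂`-stable region `M ⊆ c·log₂(𝒪_v^×)` with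
`M ⊆ c·𝔪_v⁴` (every element of norm `≤ ‖c‖·‖ϖ‖⁴`), every `γ` in the group generated by print's (Ind1)⊔(Ind2) at `v`, and every `x ∈ M`:
`‖γ x‖ ≤ ‖c‖·‖ϖ‖⁴ < ‖c‖·‖ϖ‖³` — print's indeterminacies AS TYPED never produce an element of the container's top shell from a deep region,
whereas Dupuy–Hilado's `Aut_{ℚ₂}(K_v : I_v)` generates all of `c·log₂(𝒪_v^×)` from any region of content `c` (abc-iut-w5-d180), and whereas at
every TAME place of local degree `≥ 2` the ceiling's top `‖c‖·p^{−1/e}` is attained (R19 `isGreatest_norm_add_inter_ker_of_tame`).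
[cite: Mochizuki2012, IUTchIII Thm. 3.11 (i) (Ind1)(Ind2) p. 154; Cor. 3.12 Step (xi) p. 183] [cite: DupuyHilado2025, §4.9]
[claim: Mochizuki2012, status: disputed] -/
theorem norm_of_apply_lt_of_deep
    {γ : Carrier (.inr v : Place F) ≃ₗ[ℚ] Carrier (.inr v : Place F)}
    (hγ : γ ∈ Subgroup.closure (ind1Strip (analyticLogv F) v ∪ ismIsm (analyticLogv F) v)) {c : ℚ_[2]} (hc : c ≠ 0)
    (M : AddSubgroup (RescaledCompletion F 2 v hv))
    (hMs : ∀ u : ℚ_[2], ‖u‖ ≤ 1 → ∀ z ∈ M, u • z ∈ M)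
    (hM : (M : Set (RescaledCompletion F 2 v hv)) ⊆ c • logUnits (RescaledCompletion F 2 v hv))
    (hdeep : ∀ m ∈ M, ‖m‖ ≤ ‖c‖ * ‖(ϖ : RescaledCompletion F 2 v hv)‖ ^ (4 : ℤ))
    {x : v.adicCompletion F} (hx : RescaledCompletion.of F 2 v hv x ∈ M) :
    ‖RescaledCompletion.of F 2 v hv (γ x)‖ ≤ ‖c‖ * ‖(ϖ : RescaledCompletion F 2 v hv)‖ ^ (4 : ℤ) ∧
      ‖RescaledCompletion.of F 2 v hv (γ x)‖ < ‖c‖ * ‖(ϖ : RescaledCompletion F 2 v hv)‖ ^ (3 : ℤ) := by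
  have h := norm_of_apply_le_max_of_mem_closure_ind_of_dyadicSqrtNegOne v hv hi he hf hϖ hγ c M hMs hM hdeep hx
  rw [max_self] at h
  exact ⟨h, h.trans_lt (norm_mul_zpow_four_lt_norm_mul_zpow_three v hv hϖ hc)⟩

end DyadicSqrtNegOne

/-! ## §5 The hypotheses in global terms: `√−1 ∈ K_v` and local degree `2` -/

/-- The image in `K_v^{(1/n_v)}` of an `s ∈ F` with `s² = −1` squares to `−1`. [cite: NeukirchANT1999, Ch. II Prop. (6.8)] -/
theorem sq_of_algebraMap_eq_neg_one' {s : F} (hs : s ^ 2 = -1) :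
    (RescaledCompletion.of F 2 v hv (algebraMap F (v.adicCompletion F) s)) ^ 2 = -1 := by
  rw [← map_pow, ← map_pow, hs, map_neg, map_one, map_neg, map_one]

/-- **`√−1 ∈ K_v` and `[K_v : ℚ₂] = 2` give `(e(v|2), f(v|2)) = (2, 1)`**: `√−1` forces `e ≥ 2` (abc-iut-w5-d039
`two_le_absRamificationIdx_two_of_sq_eq_neg_one`) and `e·f = [K_v : ℚ₂] = 2`.  So for a number field containing `√−1` the places of this
file are exactly its dyadic places of local degree `2`. [cite: NeukirchANT1999, Ch. II Prop. (5.7), (6.8)] -/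
theorem absRamificationIdx_eq_two_and_residueDegree_eq_one_of_localDeg_eq_two {i : RescaledCompletion F 2 v hv} (hi : i ^ 2 = -1)
    (hd : localDeg F v = 2) :
    absRamificationIdx 2 (RescaledCompletion F 2 v hv) = 2 ∧ residueDegree 2 (RescaledCompletion F 2 v hv) = 1 := by
  have h2e : 2 ≤ absRamificationIdx 2 (RescaledCompletion F 2 v hv) :=
    two_le_absRamificationIdx_two_of_sq_eq_neg_one 2 (RescaledCompletion F 2 v hv) rfl hi
  have hef := absRamificationIdx_mul_residueDegree 2 (RescaledCompletion F 2 v hv)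
  rw [finrank_rescaledCompletion_eq_localDeg, hd] at hef
  have hf1 : 1 ≤ residueDegree 2 (RescaledCompletion F 2 v hv) := residueDegree_pos 2 _
  have he2 : absRamificationIdx 2 (RescaledCompletion F 2 v hv) ≤ 2 := by
    calc absRamificationIdx 2 (RescaledCompletion F 2 v hv)
        ≤ absRamificationIdx 2 (RescaledCompletion F 2 v hv) * residueDegree 2 (RescaledCompletion F 2 v hv) :=
          Nat.le_mul_of_pos_right _ hf1
      _ = 2 := hef
  have he : absRamificationIdx 2 (RescaledCompletion F 2 v hv) = 2 := le_antisymm he2 h2e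
  refine ⟨he, ?_⟩
  rw [he] at hef
  omega

/-- **The displayed equivalence at every dyadic place of local degree `2` of a number field containing `√−1`** (e.g. the field of moduli
`F` of an initial Θ-datum, [IUTchI] Def. 3.1 (a)): for `s ∈ F`, `s² = −1`, a place `v ∣ 2` with `[K_v : ℚ₂] = 2`, every `c ∈ ℚ₂` and region
`0 ∈ M ⊆ c·log₂(𝒪_v^×)` with maximal norm `r`: hull(ceiling of print's (Ind1)⊔(Ind2) orbit span) = hull(Dupuy–Hilado's container span) ⟺
`r = ‖c‖·‖ϖ‖³`. [cite: Mochizuki2012, IUTchI Def. 3.1 (a) p. 61; IUTchIII Thm. 3.11 (i) p. 154; Cor. 3.12 Step (xi) p. 183] [cite: DupuyHilado2025,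
§4.9, §4.12] [claim: Mochizuki2012, status: disputed] -/
theorem coe_span_add_inter_ker_eq_coe_span_smul_logUnits_iff_of_localDeg_eq_two {s : F} (hs : s ^ 2 = -1) (hd : localDeg F v = 2)
    {ϖ : (RescaledCompletion F 2 v hv)ˣ} (hϖ : IsUniformizer ϖ) (c : ℚ_[2]) {M : Set (RescaledCompletion F 2 v hv)} {r : ℝ}
    (h0 : (0 : RescaledCompletion F 2 v hv) ∈ M) (hM : M ⊆ c • logUnits (RescaledCompletion F 2 v hv))
    (hMr : IsGreatest ((‖·‖) '' M) r) :
    (Submodule.span (Valued.integer (RescaledCompletion F 2 v hv))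
        (M + (c • logUnits (RescaledCompletion F 2 v hv) ∩ {w | Algebra.trace ℚ_[2] (RescaledCompletion F 2 v hv) w = 0})) :
        Set (RescaledCompletion F 2 v hv)) =
      Submodule.span (Valued.integer (RescaledCompletion F 2 v hv)) (c • logUnits (RescaledCompletion F 2 v hv)) ↔
      r = ‖c‖ * ‖(ϖ : RescaledCompletion F 2 v hv)‖ ^ (3 : ℤ) := by
  have hi := sq_of_algebraMap_eq_neg_one' v hv hs
  obtain ⟨he, hf⟩ := absRamificationIdx_eq_two_and_residueDegree_eq_one_of_localDeg_eq_two v hv hi hd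
  exact coe_span_add_inter_ker_eq_coe_span_smul_logUnits_iff v hv hi he hf hϖ c h0 hM hMr

end Summit.ABC.IUTFork.Thm311.Real

end
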